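/-
Copyright (c) 2026 the pub-hodgecm-mathlib formalisation cell (harness21).  Prover seat hodgecm-mathlib-K2E4-p11 (g6), Track B ∕ K2-LIT, h413 = `stmt-HodgeConjecture-24833`,
line `K2_E1_TraceFormulaBeta`, campaign «5Res ENDGAME BY FAMILIES», ROADCARD §3′ D4′c (SD), dealer K2E1-plan (g7) deals (241)∕(250) «(ii) FILE C (fixed-T residue ∕ Gram ⟹ hreal∕hnn)»: the
FIXED-`T` RESIDUE INEQUALITY of the diagonal Maass–Selberg four-term at a real pole `c > ½` — `‖u‖² ≤ Cμ·CK·Re r` for the residue `u` of the family and the residue `r` of the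
holomorphic pairing — hence `Re r ≥ 0`; and `Im r = 0` from reality on the axis.  Abstract (any normed `H`), `ρ₀ = 1`.
-/
import Summits.HodgeConjecture.HodgeConjecture.Theorems.K2E1MaassSelbergDiagonalRealAxisVector   -- ★ p860505 (this seat): `fourTerm_pairing_diag_eq` (the recombined four-term); brings ★ α, ★ p860128, `conj_ofReal_cpow`
import HarnessLib

/-!
# D4′c (SD), FILE C — `K2E1MaassSelbergResiduePositivity`: at a real pole `c > ½`, the residue `u = lim (z−c)•F z` of a family with `‖F z‖² = R₁(z; a, w z, b z)` (`b ≥ 0`) and the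
# residue `r = lim (z−c)·w z` of its holomorphic pairing satisfy `‖u‖² ≤ Cμ·CK·Re r`; so `Re r ≥ 0`, and `Im r = 0` when `w` is real on the real axis — the `hreal`∕`hnn` inputs of ★ p860415 §2

Track B ∕ K2-LIT, crux h413 = `stmt-HodgeConjecture-24833`, route of record `HCCMUnconditional`; cell `hodgecm-mathlib`, squad K2, ENGINE E1; dealer K2E1-plan (g7) (250): «(ii) FILE C (fixed-T
residue∕Gram ⟹ `hreal`∕`hnn`)».  THEOREMS ONLY (no `def`, no `instance`, no `notation`, no named-fact hypothesis, no `sorry`); lane `--supports stmt-HodgeConjecture-24833 --as helper`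
(count-neutral).  Closes no socket.  ABSTRACT: `H` any normed group (E1: `L²(X_U, μ)`, `F z = [Λ^T E(z, v)]`); the pairing currency `(a, w, b)` of ★ vector-α with `ρ₀ = 1` (`U(1,1)`).

THE MATHEMATICS ([MoeglinWaldspurger1995, IV.3.12 (a)]; [Langlands1976, §7, Lemma 7.5–7.6]; [Arthur1980TraceFormulaII, §4]) — the residue form of the Maass–Selberg relation AT FIXED `T`,
read along the VERTICAL path `z = c + iy`, `y ↓ 0`, on which `z + z̄ − 1 = 2c − 1` and `z − z̄ = 2iy` are explicit: with `m(y) := (z − c)·w(z) = iy·w(c+iy) → r` and `k = T^{−(z−z̄)}·w`,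
`|z−c|²·(conj k − k)∕(z − z̄) = (T^{2iy}·conj m(y) + T^{−2iy}·m(y))∕2 → Re r`, `|z−c|²·T^{2c−1}∕(2c−1)·a → 0`, and the fourth summand is `−T^{1−2c}∕(2c−1)·|z−c|²·b(z) ≤ 0`.  Hence
`‖(z−c)•F z‖² ≤ Cμ·CK·( y²·T^{2c−1}a∕(2c−1) + Re(…) ) → Cμ·CK·Re r`, i.e. **`‖u‖² ≤ Cμ·CK·Re r`** (§2) — in E1: `‖Res_c Λ^T E(·,v)‖² ≤ Cμ·CK·Re Res_c⟪M(z)v, v⟫`, the residue operator is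
NON-NEGATIVE; and `r` is REAL because `(x − c)·w(x)` is real for real `x` near `c` (§1).  With ★ `K2E1ResidueOperatorLettersOfGram.hRsymm_hRpos_of_inner_self_real_nonneg` this pays `hRsymm`∕`hRpos`
once the (SD) assembler identifies `r` with (a positive multiple of) `⟪v, R_c v⟫`.
* §1 **`im_eq_zero_of_tendsto_of_real`** (`Im r = 0`: the limit along the real axis of real numbers).
* §2 `normSq_sub_smul_eq_vertical` (the identity on the vertical path), HEAD **`normSq_residue_le_of_diag`** (`‖u‖² ≤ Cμ·CK·Re r`) and **`re_residue_nonneg_of_diag`** (`0 ≤ Re r` for `Cμ·CK > 0`).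
HONEST LABEL: HC_CM is proved only modulo the 7 printed citations (2 remaining named inputs: hLiu418 = `stmt-HodgeConjecture-24832`, h413 = `stmt-HodgeConjecture-24833`) until rung 0
closes; this file asserts no named fact and closes no socket; count-neutral; unconditional (binder form).

## References
* [MoeglinWaldspurger1995] C. Mœglin, J.-L. Waldspurger, *Spectral decomposition and Eisenstein series* (1995), IV.3.12 (a).
* [Langlands1976] R. P. Langlands, *On the Functional Equations Satisfied by Eisenstein Series*, LNM 544 (1976), §7.
* [Arthur1980TraceFormulaII] J. Arthur, *A trace formula for reductive groups II*, Compositio Math. 40 (1980), §4.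
-/

set_option autoImplicit false
-- the mandated namespace repeats the single-problem summit's segment (`HodgeConjecture.HodgeConjecture`)
set_option linter.dupNamespace false

noncomputable section

open Set Filter Topology Metric Complex
open scoped ComplexConjugate
open Literature.NumberTheory.EllipticCurves.ModularForms (conj_ofReal_cpow)
open Summit.HodgeConjecture.HodgeConjecture.Cruxes.H413.K2E1MaassSelbergDiagonalRealAxisVector (fourTerm_pairing_diag_eq)

namespace Summit.HodgeConjecture.HodgeConjecture.Cruxes.H413.K2E1MaassSelbergResiduePositivity

/-! ## §1 The residue of a pairing that is real on the real axis is real -/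

/-- **`Im r = 0`**: if `w` is real at the real points near `c` and `(z − c)·w z → r` (`z → c`, `z ≠ c`), then `r` is real (the limit along the real axis of real numbers). [folklore] -/
theorem im_eq_zero_of_tendsto_of_real {w : ℂ → ℂ} {c : ℝ} {r : ℂ} (hr : Tendsto (fun z : ℂ => (z - c) * w z) (𝓝[≠] (c : ℂ)) (𝓝 r))
    (hreal : ∀ᶠ x : ℝ in 𝓝[≠] c, (w (x : ℂ)).im = 0) : r.im = 0 := by
  have ht : Tendsto (fun x : ℝ => (x : ℂ)) (𝓝[≠] c) (𝓝[≠] (c : ℂ)) := by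
    refine tendsto_nhdsWithin_of_tendsto_nhds_of_eventually_within _ ((continuous_ofReal.tendsto c).mono_left nhdsWithin_le_nhds) ?_
    filter_upwards [self_mem_nhdsWithin] with x hx
    simp only [mem_compl_iff, mem_singleton_iff] at hx ⊢
    exact fun h => hx (ofReal_injective h)
  have h1 : Tendsto (fun x : ℝ => (((x : ℂ) - c) * w (x : ℂ)).im) (𝓝[≠] c) (𝓝 r.im) :=
    (continuous_im.tendsto r).comp (hr.comp ht)
  have h0 : ∀ᶠ x : ℝ in 𝓝[≠] c, (((x : ℂ) - c) * w (x : ℂ)).im = 0 := by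
    filter_upwards [hreal] with x hx
    rw [mul_im, hx, ← ofReal_sub, ofReal_im, ofReal_re, mul_zero, zero_mul, add_zero]
  exact tendsto_nhds_unique (h1.congr' h0) tendsto_const_nhds

/-! ## §2 The fixed-`T` residue inequality along the vertical path `z = c + iy` -/

section Vertical

variable {H : Type*} [NormedAddCommGroup H] [NormedSpace ℂ H]

/-- **THE WEIGHTED FOUR-TERM ON THE VERTICAL PATH** `z = c + iy` (`y ≠ 0`, `c ≠ ½`): `z + z̄ − 1 = 2c − 1`, `z − z̄ = 2iy`, and
`y²·R₁(z; a, w, b) = Cμ·CK·( y²·T^{2c−1}∕(2c−1)·a + (T^{2iy}·conj m + T^{−2iy}·m)∕2 − T^{1−2c}∕(2c−1)·(y²·b) )` with `m := iy·w`. [cite: MoeglinWaldspurger1995, IV.3.12 (a)] -/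
theorem weight_fourTerm_vertical (Cμ CK : ℝ) {T : ℝ} (hT : 0 < T) (a bz : ℝ) {c : ℝ} (hc : 1 / 2 < c) (wz : ℂ) {y : ℝ} (hy : y ≠ 0) :
    (((y ^ 2 : ℝ)) : ℂ) * (((Cμ : ℝ) : ℂ) * (((CK : ℝ) : ℂ) *
        ((((T : ℝ) : ℂ) ^ (((c : ℂ) + y * I) + conj ((c : ℂ) + y * I) - 1) / (((c : ℂ) + y * I) + conj ((c : ℂ) + y * I) - 1)) * ((a : ℝ) : ℂ)
          + (((T : ℝ) : ℂ) ^ (((c : ℂ) + y * I) - conj ((c : ℂ) + y * I)) / (((c : ℂ) + y * I) - conj ((c : ℂ) + y * I))) * conj wz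
          - (((T : ℝ) : ℂ) ^ (-(((c : ℂ) + y * I) - conj ((c : ℂ) + y * I))) / (((c : ℂ) + y * I) - conj ((c : ℂ) + y * I))) * wz
          - (((T : ℝ) : ℂ) ^ (-(((c : ℂ) + y * I) + conj ((c : ℂ) + y * I) - 1)) / (((c : ℂ) + y * I) + conj ((c : ℂ) + y * I) - 1)) * ((bz : ℝ) : ℂ)))) =
      ((Cμ : ℝ) : ℂ) * (((CK : ℝ) : ℂ) *
        ((((y ^ 2 * (T ^ (2 * c - 1) / (2 * c - 1)) * a : ℝ)) : ℂ)
          + (((T : ℝ) : ℂ) ^ (2 * (y : ℂ) * I) * conj ((y : ℂ) * I * wz) + ((T : ℝ) : ℂ) ^ (-(2 * (y : ℂ) * I)) * ((y : ℂ) * I * wz)) / 2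
          - (((T ^ (1 - 2 * c) / (2 * c - 1) * (y ^ 2 * bz) : ℝ)) : ℂ))) := by
  have e1 : ((c : ℂ) + y * I) + conj ((c : ℂ) + y * I) - 1 = (((2 * c - 1 : ℝ)) : ℂ) := by
    simp only [map_add, map_mul, conj_ofReal, conj_I]; push_cast; ring
  have e2 : ((c : ℂ) + y * I) - conj ((c : ℂ) + y * I) = 2 * (y : ℂ) * I := by
    simp only [map_add, map_mul, conj_ofReal, conj_I]; ring
  have hT1 : ((T : ℝ) : ℂ) ^ ((((2 * c - 1 : ℝ)) : ℂ)) = (((T ^ (2 * c - 1) : ℝ)) : ℂ) := (ofReal_cpow hT.le _).symm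
  have hT2 : ((T : ℝ) : ℂ) ^ (-((((2 * c - 1 : ℝ)) : ℂ))) = (((T ^ (1 - 2 * c) : ℝ)) : ℂ) := by
    rw [← ofReal_neg, ← ofReal_cpow hT.le]; congr 1; ring_nf
  have h2c : (((2 * c - 1 : ℝ)) : ℂ) ≠ 0 := ofReal_ne_zero.2 (by linarith)
  have hy' : (y : ℂ) ≠ 0 := ofReal_ne_zero.2 hy
  have hyI : (2 * (y : ℂ) * I) ≠ 0 := mul_ne_zero (mul_ne_zero two_ne_zero hy') I_ne_zero
  rw [e1, e2, hT1, hT2]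
  simp only [map_mul, conj_ofReal, conj_I]
  push_cast
  field_simp
  ring_nf
  simp only [I_sq]
  ring_nf

/-- **THE FIXED-`T` RESIDUE INEQUALITY** (`ρ₀ = 1`, real pole `c > ½`): if `‖F z‖² = R₁(z; a, w z, b z)` off the real axis near `c` with `b ≥ 0` there, `(z − c)·w z → r` and `(z − c)•F z → u`
(`z → c`, `z ≠ c`), and `Cμ·CK ≥ 0`, then **`‖u‖² ≤ Cμ·CK·Re r`** — the vertical path `z = c + iy`, `y ↓ 0`: the first summand of `y²·R₁` is `O(y²)`, the middle one tends to `Re r`, the last is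
`≤ 0`. [cite: MoeglinWaldspurger1995, IV.3.12 (a)] [cite: Langlands1976, §7] -/
theorem normSq_residue_le_of_diag (Cμ CK : ℝ) {T : ℝ} (hT : 0 < T) (a : ℝ) {b : ℂ → ℝ} {w : ℂ → ℂ} {c : ℝ} (hc : 1 / 2 < c) (hpos : 0 ≤ Cμ * CK)
    (hb0 : ∀ᶠ z : ℂ in 𝓝[≠] (c : ℂ), 0 ≤ b z)
    {r : ℂ} (hr : Tendsto (fun z : ℂ => (z - c) * w z) (𝓝[≠] (c : ℂ)) (𝓝 r))
    (F : ℂ → H) {u : H} (hu : Tendsto (fun z : ℂ => (z - c) • F z) (𝓝[≠] (c : ℂ)) (𝓝 u))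
    (hdiag : ∀ᶠ z : ℂ in 𝓝[≠] (c : ℂ), z.im ≠ 0 → (((‖F z‖ ^ 2 : ℝ)) : ℂ) =
      ((Cμ : ℝ) : ℂ) * (((CK : ℝ) : ℂ) *
        ((((T : ℝ) : ℂ) ^ (z + conj z - 1) / (z + conj z - 1)) * ((a : ℝ) : ℂ)
          + (((T : ℝ) : ℂ) ^ (z - conj z) / (z - conj z)) * conj (w z)
          - (((T : ℝ) : ℂ) ^ (-(z - conj z)) / (z - conj z)) * w z
          - (((T : ℝ) : ℂ) ^ (-(z + conj z - 1)) / (z + conj z - 1)) * ((b z : ℝ) : ℂ)))) :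
    ‖u‖ ^ 2 ≤ Cμ * CK * r.re := by
  -- the vertical path `p y = c + iy`, `y ↓ 0`
  set p : ℝ → ℂ := fun y => (c : ℂ) + y * I with hp_def
  have hpc : ∀ y : ℝ, p y - c = (y : ℂ) * I := fun y => by simp only [hp_def]; ring
  have hp : Tendsto p (𝓝[>] (0 : ℝ)) (𝓝[≠] (c : ℂ)) := by
    refine tendsto_nhdsWithin_of_tendsto_nhds_of_eventually_within _ ?_ ?_
    · have hcont : Continuous p := continuous_const.add (continuous_ofReal.mul continuous_const)
      have := hcont.tendsto 0
      simp only [hp_def, ofReal_zero, zero_mul, add_zero] at this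
      exact this.mono_left nhdsWithin_le_nhds
    · filter_upwards [self_mem_nhdsWithin] with y hy
      simp only [mem_compl_iff, mem_singleton_iff, mem_Ioi] at hy ⊢
      intro h
      have := congrArg Complex.im h
      simp only [hp_def, add_im, ofReal_im, mul_im, ofReal_re, I_im, I_re, mul_one, mul_zero, zero_add, add_zero] at this
      exact hy.ne' this
  -- the three convergences along the path
  have hm : Tendsto (fun y : ℝ => ((y : ℂ) * I) * w (p y)) (𝓝[>] (0 : ℝ)) (𝓝 r) := by
    have := hr.comp hp
    refine this.congr fun y => ?_
    simp only [Function.comp, hpc]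
  have hu' : Tendsto (fun y : ℝ => ‖(p y - c) • F (p y)‖ ^ 2) (𝓝[>] (0 : ℝ)) (𝓝 (‖u‖ ^ 2)) :=
    ((continuous_norm.pow 2).tendsto u).comp (hu.comp hp)
  have hζ : Tendsto (fun y : ℝ => ((T : ℝ) : ℂ) ^ (2 * (y : ℂ) * I)) (𝓝[>] (0 : ℝ)) (𝓝 1) := by
    have hcont : Continuous fun y : ℝ => ((T : ℝ) : ℂ) ^ (2 * (y : ℂ) * I) :=
      continuous_iff_continuousAt.2 fun y => (continuousAt_const_cpow (ofReal_ne_zero.2 hT.ne')).comp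
        ((continuous_const.mul continuous_ofReal).mul continuous_const).continuousAt
    have := hcont.tendsto 0
    simp only [ofReal_zero, mul_zero, zero_mul, cpow_zero] at this
    exact this.mono_left nhdsWithin_le_nhds
  have hζ' : Tendsto (fun y : ℝ => ((T : ℝ) : ℂ) ^ (-(2 * (y : ℂ) * I))) (𝓝[>] (0 : ℝ)) (𝓝 1) := by
    have hcont : Continuous fun y : ℝ => ((T : ℝ) : ℂ) ^ (-(2 * (y : ℂ) * I)) :=
      continuous_iff_continuousAt.2 fun y => (continuousAt_const_cpow (ofReal_ne_zero.2 hT.ne')).comp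
        ((continuous_const.mul continuous_ofReal).mul continuous_const).neg.continuousAt
    have := hcont.tendsto 0
    simp only [ofReal_zero, mul_zero, zero_mul, neg_zero, cpow_zero] at this
    exact this.mono_left nhdsWithin_le_nhds
  -- the dominating real sequence and its limit `Cμ·CK·Re r`
  have hG : Tendsto (fun y : ℝ => Cμ * (CK * ((y ^ 2 * (T ^ (2 * c - 1) / (2 * c - 1)) * a) +
      ((((T : ℝ) : ℂ) ^ (2 * (y : ℂ) * I) * conj (((y : ℂ) * I) * w (p y)) + ((T : ℝ) : ℂ) ^ (-(2 * (y : ℂ) * I)) * (((y : ℂ) * I) * w (p y))) / 2).re)))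
      (𝓝[>] (0 : ℝ)) (𝓝 (Cμ * CK * r.re)) := by
    have h0 : Tendsto (fun y : ℝ => (y ^ 2 * (T ^ (2 * c - 1) / (2 * c - 1)) * a)) (𝓝[>] (0 : ℝ)) (𝓝 0) := by
      have : Tendsto (fun y : ℝ => (y ^ 2 * (T ^ (2 * c - 1) / (2 * c - 1)) * a)) (𝓝 (0 : ℝ)) (𝓝 ((0 : ℝ) ^ 2 * (T ^ (2 * c - 1) / (2 * c - 1)) * a)) :=
        (((continuous_id.pow 2).mul continuous_const).mul continuous_const).tendsto 0
      simp only [ne_eq, OfNat.ofNat_ne_zero, not_false_eq_true, zero_pow, zero_mul] at this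
      exact this.mono_left nhdsWithin_le_nhds
    have hmid : Tendsto (fun y : ℝ => ((((T : ℝ) : ℂ) ^ (2 * (y : ℂ) * I) * conj (((y : ℂ) * I) * w (p y)) +
        ((T : ℝ) : ℂ) ^ (-(2 * (y : ℂ) * I)) * (((y : ℂ) * I) * w (p y))) / 2).re) (𝓝[>] (0 : ℝ)) (𝓝 r.re) := by
      have hconj : Tendsto (fun y : ℝ => conj (((y : ℂ) * I) * w (p y))) (𝓝[>] (0 : ℝ)) (𝓝 (conj r)) := (continuous_conj.tendsto r).comp hm
      have h := ((hζ.mul hconj).add (hζ'.mul hm)).div_const 2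
      have h' := (continuous_re.tendsto _).comp h
      have hval : (((1 : ℂ) * conj r + 1 * r) / 2).re = r.re := by
        have : ((1 : ℂ) * conj r + 1 * r) / 2 = ((r.re : ℝ) : ℂ) := by
          rw [one_mul, one_mul, add_comm, Complex.add_conj]; push_cast; ring
        rw [this, ofReal_re]
      rw [hval] at h'
      exact h'
    have := (h0.add hmid).const_mul CK |>.const_mul Cμ
    simpa only [zero_add, mul_assoc] using this
  -- the eventual inequality along the path
  have hle : ∀ᶠ y : ℝ in 𝓝[>] (0 : ℝ), ‖(p y - c) • F (p y)‖ ^ 2 ≤ Cμ * (CK * ((y ^ 2 * (T ^ (2 * c - 1) / (2 * c - 1)) * a) +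
      ((((T : ℝ) : ℂ) ^ (2 * (y : ℂ) * I) * conj (((y : ℂ) * I) * w (p y)) + ((T : ℝ) : ℂ) ^ (-(2 * (y : ℂ) * I)) * (((y : ℂ) * I) * w (p y))) / 2).re)) := by
    have hy0 : ∀ᶠ y : ℝ in 𝓝[>] (0 : ℝ), 0 < y := self_mem_nhdsWithin
    filter_upwards [hy0, hp.eventually hdiag, hp.eventually hb0] with y hy hyd hyb
    have hyim : (p y).im ≠ 0 := by
      simp only [hp_def, add_im, ofReal_im, mul_im, ofReal_re, I_im, I_re, mul_one, mul_zero, zero_add, add_zero]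
      exact hy.ne'
    have hid := hyd hyim
    -- multiply by `y²` and rewrite on the path
    have hvert := weight_fourTerm_vertical Cμ CK hT a (b (p y)) hc (w (p y)) hy.ne'
    have hsq : (((‖(p y - c) • F (p y)‖ ^ 2 : ℝ)) : ℂ) = (((y ^ 2 : ℝ)) : ℂ) * (((‖F (p y)‖ ^ 2 : ℝ)) : ℂ) := by
      rw [norm_smul, mul_pow, hpc, norm_mul, norm_I, mul_one, norm_real, Real.norm_eq_abs, sq_abs]; push_cast; ring
    have key : (((‖(p y - c) • F (p y)‖ ^ 2 : ℝ)) : ℂ) = ((Cμ : ℝ) : ℂ) * (((CK : ℝ) : ℂ) *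
        ((((y ^ 2 * (T ^ (2 * c - 1) / (2 * c - 1)) * a : ℝ)) : ℂ)
          + (((T : ℝ) : ℂ) ^ (2 * (y : ℂ) * I) * conj ((y : ℂ) * I * w (p y)) + ((T : ℝ) : ℂ) ^ (-(2 * (y : ℂ) * I)) * ((y : ℂ) * I * w (p y))) / 2
          - (((T ^ (1 - 2 * c) / (2 * c - 1) * (y ^ 2 * b (p y)) : ℝ)) : ℂ))) := by
      rw [hsq, hid]; exact hvert
    have keyre := congrArg Complex.re key
    rw [ofReal_re, re_ofReal_mul, re_ofReal_mul, sub_re, add_re, ofReal_re, ofReal_re] at keyre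
    rw [keyre]
    have hnn : 0 ≤ T ^ (1 - 2 * c) / (2 * c - 1) * (y ^ 2 * b (p y)) := by
      have : 0 < 2 * c - 1 := by linarith
      positivity
    have h3 : 0 ≤ Cμ * CK * (T ^ (1 - 2 * c) / (2 * c - 1) * (y ^ 2 * b (p y))) := mul_nonneg hpos hnn
    linarith [h3]
  exact le_of_tendsto_of_tendsto hu' hG hle

/-- **THE RESIDUE OF THE HOLOMORPHIC PAIRING IS REAL AND NON-NEGATIVE**: under the hypotheses of `normSq_residue_le_of_diag` with `Cμ·CK > 0`, and `w` real at the real points near `c`: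
`Im r = 0` and `0 ≤ Re r` — the `hreal`∕`hnn` inputs of ★ `K2E1ResidueOperatorLettersOfGram.hRsymm_hRpos_of_inner_self_real_nonneg` once `r` is identified with (a positive multiple of)
`⟪v, R_c v⟫`. [cite: MoeglinWaldspurger1995, IV.3.12 (a)] [cite: Langlands1976, §7] -/
theorem residue_real_nonneg_of_diag (Cμ CK : ℝ) {T : ℝ} (hT : 0 < T) (a : ℝ) {b : ℂ → ℝ} {w : ℂ → ℂ} {c : ℝ} (hc : 1 / 2 < c) (hpos : 0 < Cμ * CK)
    (hb0 : ∀ᶠ z : ℂ in 𝓝[≠] (c : ℂ), 0 ≤ b z) (hreal : ∀ᶠ x : ℝ in 𝓝[≠] c, (w (x : ℂ)).im = 0)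
    {r : ℂ} (hr : Tendsto (fun z : ℂ => (z - c) * w z) (𝓝[≠] (c : ℂ)) (𝓝 r))
    (F : ℂ → H) {u : H} (hu : Tendsto (fun z : ℂ => (z - c) • F z) (𝓝[≠] (c : ℂ)) (𝓝 u))
    (hdiag : ∀ᶠ z : ℂ in 𝓝[≠] (c : ℂ), z.im ≠ 0 → (((‖F z‖ ^ 2 : ℝ)) : ℂ) =
      ((Cμ : ℝ) : ℂ) * (((CK : ℝ) : ℂ) *
        ((((T : ℝ) : ℂ) ^ (z + conj z - 1) / (z + conj z - 1)) * ((a : ℝ) : ℂ)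
          + (((T : ℝ) : ℂ) ^ (z - conj z) / (z - conj z)) * conj (w z)
          - (((T : ℝ) : ℂ) ^ (-(z - conj z)) / (z - conj z)) * w z
          - (((T : ℝ) : ℂ) ^ (-(z + conj z - 1)) / (z + conj z - 1)) * ((b z : ℝ) : ℂ)))) :
    r.im = 0 ∧ 0 ≤ r.re := by
  refine ⟨im_eq_zero_of_tendsto_of_real hr hreal, ?_⟩
  have h := normSq_residue_le_of_diag Cμ CK hT a hc hpos.le hb0 hr F hu hdiag
  have h0 : Cμ * CK * 0 ≤ Cμ * CK * r.re := by rw [mul_zero]; exact (sq_nonneg ‖u‖).trans h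
  exact le_of_mul_le_mul_left h0 hpos

end Vertical

end Summit.HodgeConjecture.HodgeConjecture.Cruxes.H413.K2E1MaassSelbergResiduePositivity

end
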